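import Summits.Ventures.YMGap.Thresholds.PlaquetteSusceptibility
import HarnessLib

/-!
# Venture YMGap — EXTENSIVE BOUND ON THE ENERGY VARIANCE: inside the strong-coupling window the variance of the total
# plaquette energy of any finite region is at most `χ` times the number of plaquettes (bounded specific heat per plaquette)

HONEST FRAMING: venture file of the cell `pub-ymgap` (QuantumFields programme), seat ds-1; corollary of
`PlaquetteSusceptibility` (finite plaquette susceptibility from the mass-gap currency `MassGapAt d N β`).  Strong-coupling
LATTICE statement for `SU(N)` lattice Yang–Mills on `ℤ^d`; «specific heat» here means the variance density
`Var_μ(Σ_{p ∈ P} W_p)/#P` of the normalised plaquette energy `W_p = (1/N) Re tr U_p` over a finite set `P` of plaquettes —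
its boundedness, uniformly in `P`, excludes a divergent energy fluctuation INSIDE the window; nothing about the continuum,
critical behaviour elsewhere, or the Clay problem.

* `variance_sum_plaquette_le_of_massGapAt` — `MassGapAt d N β` ⇒ for every DLR state `μ` one `χ` with
  `Var_μ(Σ_{p ∈ P} W_p) ≤ χ · #P` for EVERY finite set `P` of plaquettes of `ℤ^d` (`Var = Σ_p Σ_q Cov ≤ Σ_p Σ'_q |Cov| ≤ #P χ`).
* Rows: `su2_variance_sum_plaquette_le` (`SU(2)`, `d = 4`, `|β| ≤ 9/100` 't Hooft, i.e. Wilson `β_W ≤ 0.36`);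
  `variance_sum_plaquette_le_SU` (every `N ≥ 2`, `d = 4`, `|β| ≤ 9/308`).

References (mechanism): B. Simon, *The Statistical Mechanics of Lattice Gases* I (1993), §II.12; H. Shen, R. Zhu, X. Zhu, CMP
400 (2023), Cor. 1.6.
-/

noncomputable section

open MeasureTheory Function Finset ProbabilityTheory Real
open scoped NNReal
open Literature.Probability.LatticeModels
open Literature.MathematicalPhysics.QuantumLattice (fundamentalRep fundamentalRep_mem_unitaryGroup ymSpecification ymGibbsMeasures
  LGConfig ZdPlaquette)
open Literature.MathematicalPhysics.QuantumFieldTheory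
open Summit.Ventures.YMGap.PlaquetteSusceptibility

namespace Summit.Ventures.YMGap.PlaquetteEnergyVariance

variable {d N : ℕ}

/-- **Extensive bound on the energy variance from the mass-gap currency.**  `MassGapAt d N β` (`d ≥ 1`) ⇒ for every DLR
state `μ` at 't Hooft coupling `β` there is one `χ` with `Var_μ(Σ_{p ∈ P} W_p) ≤ χ · #P` for every finite set `P` of plaquettes,
`W_p = (1/N) Re tr U_p`. [cite: arXiv220412737, Cor. 1.6 (Mass gap)] -/
theorem variance_sum_plaquette_le_of_massGapAt (hd : 1 ≤ d) {β : ℝ} (h : MassGapAt d N β)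
    {μ : Measure (LGConfig d (Matrix.specialUnitaryGroup (Fin N) ℂ))}
    (hμ : μ ∈ ymGibbsMeasures (d := d) (fundamentalRep (Fin N)) (N * β)) :
    ∃ χ : ℝ, ∀ P : Finset (ZdPlaquette d),
      Var[fun U => ∑ p ∈ P, zdPlaquetteObs (fundamentalRep (Fin N)) p.1 p.2.1.1 p.2.1.2 U; μ] ≤ χ * P.card := by
  classical
  haveI : SecondCountableTopology (Matrix (Fin N) (Fin N) ℂ) :=
    inferInstanceAs (SecondCountableTopology (Fin N → Fin N → ℂ))
  haveI : SecondCountableTopology (Matrix.specialUnitaryGroup (Fin N) ℂ) :=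
    Topology.IsEmbedding.subtypeVal.secondCountableTopology
  have hμ' : IsGibbsMeasure (ymSpecification (d := d) (fundamentalRep (Fin N)) (N * β)) μ := hμ
  haveI := hμ'.isProbabilityMeasure
  obtain ⟨χ, hχ⟩ := summable_abs_cov_plaquette_of_massGapAt hd h hμ
  refine ⟨χ, fun P => ?_⟩
  set W : ZdPlaquette d → LGConfig d (Matrix.specialUnitaryGroup (Fin N) ℂ) → ℝ :=
    fun p => zdPlaquetteObs (fundamentalRep (Fin N)) p.1 p.2.1.1 p.2.1.2 with hW
  -- each plaquette observable is bounded measurable, hence in `L²`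
  have hWm : ∀ p : ZdPlaquette d, MemLp (W p) 2 μ := fun p =>
    memLp_of_bounded (a := -1) (b := 1)
      (ae_of_all _ fun U => by
        have h1 := abs_zdPlaquetteObs_le fundamentalRep_mem_unitaryGroup p.1 p.2.1.1 p.2.1.2 U
        simp only [Set.mem_Icc]; exact abs_le.1 h1)
      (isLipschitzCylinder_zdPlaquetteObs p.1 p.2.2).measurable.aestronglyMeasurable 2
  have hvar : Var[fun U => ∑ p ∈ P, W p U; μ] = ∑ p ∈ P, ∑ q ∈ P, cov[W p, W q; μ] := by
    have hsum : (fun U => ∑ p ∈ P, W p U) = ∑ p ∈ P, W p := by funext U; simp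
    rw [hsum, ← covariance_self (memLp_finsetSum' P fun p _ => hWm p).aestronglyMeasurable.aemeasurable,
      covariance_sum_sum' (fun p _ => hWm p) (fun q _ => hWm q)]
  rw [hvar]
  calc ∑ p ∈ P, ∑ q ∈ P, cov[W p, W q; μ] ≤ ∑ p ∈ P, ∑ q ∈ P, |cov[W p, W q; μ]| :=
        Finset.sum_le_sum fun p _ => Finset.sum_le_sum fun q _ => le_abs_self _
    _ ≤ ∑ p ∈ P, ∑' q : ZdPlaquette d, |cov[W p, W q; μ]| :=
        Finset.sum_le_sum fun p _ => (hχ p).1.sum_le_tsum P fun q _ => abs_nonneg _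
    _ ≤ ∑ _p ∈ P, χ := Finset.sum_le_sum fun p _ => (hχ p).2
    _ = χ * P.card := by rw [Finset.sum_const, nsmul_eq_mul, mul_comm]

/-- **`SU(2)`, `d = 4`, hypothesis-free**: at every 't Hooft `|β| ≤ 9/100` (Wilson `β_W ≤ 0.36`), every DLR state has
`Var_μ(Σ_{p∈P} W_p) ≤ χ · #P` for all finite plaquette sets `P`. [cite: arXiv220412737, Cor. 1.6 (Mass gap)] -/
theorem su2_variance_sum_plaquette_le {β : ℝ} (hβ : |β| ≤ 9 / 100)
    {μ : Measure (LGConfig 4 (Matrix.specialUnitaryGroup (Fin 2) ℂ))}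
    (hμ : μ ∈ ymGibbsMeasures (d := 4) (fundamentalRep (Fin 2)) (2 * β)) :
    ∃ χ : ℝ, ∀ P : Finset (ZdPlaquette 4),
      Var[fun U => ∑ p ∈ P, zdPlaquetteObs (fundamentalRep (Fin 2)) p.1 p.2.1.1 p.2.1.2 U; μ] ≤ χ * P.card :=
  variance_sum_plaquette_le_of_massGapAt (by norm_num) (ImprovedThresholdStar.su2_massGapAt_of_abs_le hβ) hμ

/-- **Every `SU(N)`, `N ≥ 2`, `d = 4`, hypothesis-free**: at every 't Hooft `|β| ≤ 9/308`, every DLR state has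
`Var_μ(Σ_{p∈P} W_p) ≤ χ · #P` for all finite plaquette sets `P`. [cite: arXiv220412737, Cor. 1.6 (Mass gap)] -/
theorem variance_sum_plaquette_le_SU (hN : 2 ≤ N) {β : ℝ} (hβ : |β| ≤ 9 / 308)
    {μ : Measure (LGConfig 4 (Matrix.specialUnitaryGroup (Fin N) ℂ))}
    (hμ : μ ∈ ymGibbsMeasures (d := 4) (fundamentalRep (Fin N)) (N * β)) :
    ∃ χ : ℝ, ∀ P : Finset (ZdPlaquette 4),
      Var[fun U => ∑ p ∈ P, zdPlaquetteObs (fundamentalRep (Fin N)) p.1 p.2.1.1 p.2.1.2 U; μ] ≤ χ * P.card :=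
  variance_sum_plaquette_le_of_massGapAt (by norm_num) (StarSUNLimit.massGapAt_SU_star hN hβ) hμ

end Summit.Ventures.YMGap.PlaquetteEnergyVariance

end
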